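import Literature.Analysis.FunctionSpaces.TorusCellwiseHNegOne
import Literature.Analysis.FunctionSpaces.TorusInverseLaplacianL2
import Literature.Analysis.FunctionSpaces.Complexify
import HarnessLib

/-!
# `H⁻¹`-smallness of cellwise mean-free vector fields on the flat torus

Topic `Literature/Analysis/FunctionSpaces` (flat torus, spectral Sobolev scale). Companion of
`TorusCellwiseHNegOne.lean`: the inhomogeneous, vector-valued (complexified) form of the scalar
homogeneous estimate `Torus.eHomSobolevSeminorm_neg_one_le_of_cellwise` (Bruè–De Lellis 2023,
Thm. 4.1 (b)). A continuous field whose lift has integral zero on every cell of mesh `m⁻¹` of the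
fundamental cube is small in `H⁻¹(T^d)`, with a bound `O(1/m)` times its sup norm — the form in
which fine-scale increments of convex-integration schemes are controlled in negative Sobolev
norms (e.g. Choffrut–Székelyhidi 2014, §2 Step 3, used by
`Literature.Analysis.FluidPDE.Torus.ChoffrutSzekelyhidi2014_thm1`):

* `eSobolevNorm_neg_one_le_eHomSobolevSeminorm` — for a mean-free function the inhomogeneous
  `H⁻¹` norm is at most the homogeneous one (`(1+|k|²)⁻¹ ≤ |k|⁻²` off the zero mode);
* `tsum_sobolev_complexify_eq_sum` — the `H^s` sum of `complexify ∘ V` is the sum over the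
  coordinates of the `H^s` sums of the coordinates;
* `eSobolevNorm_neg_one_complexify_le_of_cellwise` — **the bound**: for continuous
  `V : T^d → ℝ^d` with `‖V‖ ≤ M` whose coordinates have integral zero on every cell of mesh `m⁻¹`,
  `‖complexify ∘ V‖_{H⁻¹} ≤ √d · (2π √d / m) · 2^{d/2} · M`.

## References

* E. Bruè, C. De Lellis, *Anomalous dissipation for the forced 3D Navier–Stokes equations*,
  Comm. Math. Phys. 400 (2023), Thm. 4.1 (b) (the cellwise `H⁻¹` bound). [BrueDeLellisCMP2023]
* A. Choffrut, L. Székelyhidi Jr., SIAM J. Math. Anal. 46 (2014), §2, Step 3 (use in convex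
  integration). [ChoffrutSzekelyhidi2014]
* L. Grafakos, *Classical Fourier Analysis*, §3.1–3.3 (Fourier series on `T^d`).
-/

noncomputable section

open scoped ENNReal
open Set Function MeasureTheory UnitAddTorus

namespace Literature.Analysis.FunctionSpaces

namespace Torus

variable {d : Type*} [Fintype d]

/-! ## Inhomogeneous versus homogeneous `H⁻¹` -/

omit [Fintype d] in
/-- The square of the weight `⟨k⟩^{-1}`. [folklore] -/
theorem sobolevWeight_neg_one_sq [Fintype d] (k : d → ℤ) : sobolevWeight (-1) k ^ 2 = (1 + freqNormSq k)⁻¹ := by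
  have h0 : 0 ≤ 1 + freqNormSq k := by linarith [freqNormSq_nonneg k]
  rw [sobolevWeight, ← Real.rpow_natCast, ← Real.rpow_mul h0]
  norm_num
  exact Real.rpow_neg_one (1 + freqNormSq k)

/-- **Mean-free functions: `‖g‖_{H⁻¹} ≤ |g|_{Ḣ⁻¹}`.** [folklore] -/
theorem eSobolevNorm_neg_one_le_eHomSobolevSeminorm {F : Type*} [NormedAddCommGroup F] [NormedSpace ℂ F]
    {g : UnitAddTorus d → F} (h0 : mFourierCoeff g 0 = 0) :
    eSobolevNorm (-1) g ≤ eHomSobolevSeminorm (-1) g := by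
  unfold eSobolevNorm eHomSobolevSeminorm
  refine ENNReal.rpow_le_rpow (ENNReal.tsum_le_tsum fun k => ?_) (by norm_num)
  by_cases hk : k = 0
  · subst hk; simp [h0]
  · rw [if_neg hk]
    refine mul_le_mul_left ?_ _
    refine ENNReal.ofReal_le_ofReal ?_
    rw [sobolevWeight_neg_one_sq, Real.rpow_neg_one]
    have hpos : 0 < freqNormSq k := lt_of_lt_of_le one_pos (one_le_freqNormSq_of_ne_zero hk)
    exact inv_anti₀ hpos (by linarith)

/-! ## Coordinates of complexified fields -/

/-- The squared extended norm on `ℂ^d` is the sum of the squared extended norms of the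
coordinates. [folklore] -/
theorem enorm_sq_eq_sum_enorm_apply_sq (z : EuclideanSpace ℂ d) : ‖z‖ₑ ^ 2 = ∑ i, ‖z i‖ₑ ^ 2 := by
  rw [← ofReal_norm, ← ENNReal.ofReal_pow (norm_nonneg _), EuclideanSpace.norm_sq_eq,
    ENNReal.ofReal_sum_of_nonneg fun i _ => sq_nonneg _]
  exact Finset.sum_congr rfl fun i _ => by rw [ENNReal.ofReal_pow (norm_nonneg _), ofReal_norm]

/-- **The `H^s` sum of a complexified field is the sum of the `H^s` sums of its coordinates.**
[folklore] -/
theorem tsum_sobolev_complexify_eq_sum {V : UnitAddTorus d → EuclideanSpace ℝ d} (hV : Integrable V volume) (s : ℝ) :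
    ∑' k : d → ℤ, ENNReal.ofReal (sobolevWeight s k ^ 2) * ‖mFourierCoeff (EuclideanSpace.complexify ∘ V) k‖ₑ ^ 2 =
      ∑ i, ∑' k : d → ℤ, ENNReal.ofReal (sobolevWeight s k ^ 2) * ‖mFourierCoeff (fun x => (V x i : ℂ)) k‖ₑ ^ 2 := by
  rw [← Summable.tsum_finsetSum fun i _ => ENNReal.summable]
  refine tsum_congr fun k => ?_
  rw [enorm_sq_eq_sum_enorm_apply_sq, Finset.mul_sum]
  exact Finset.sum_congr rfl fun i _ => by rw [mFourierCoeff_complexify_apply hV k i]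

/-- Consequently `‖complexify ∘ V‖_{H^s}² = Σ_i ‖V_i‖_{H^s}²`. [folklore] -/
theorem eSobolevNorm_complexify_sq {V : UnitAddTorus d → EuclideanSpace ℝ d} (hV : Integrable V volume) (s : ℝ) :
    eSobolevNorm s (EuclideanSpace.complexify ∘ V) ^ (2 : ℝ) = ∑ i, eSobolevNorm s (fun x => (V x i : ℂ)) ^ (2 : ℝ) := by
  unfold eSobolevNorm
  rw [← ENNReal.rpow_mul, show (1 / 2 : ℝ) * 2 = 1 by norm_num, ENNReal.rpow_one, tsum_sobolev_complexify_eq_sum hV s]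
  exact Finset.sum_congr rfl fun i _ => by rw [← ENNReal.rpow_mul, show (1 / 2 : ℝ) * 2 = 1 by norm_num, ENNReal.rpow_one]

/-! ## The bound -/

/-- The zero mode of a real function with vanishing cell integrals vanishes. [folklore] -/
theorem mFourierCoeff_zero_eq_zero_of_cellwise [DecidableEq d] {f : UnitAddTorus d → ℝ} (hf : Continuous f)
    {m : ℕ} (hm : 0 < m) (h0 : ∀ κ : d → Fin m, ∫ y in latticeCell m (fun i => ((κ i : ℕ) : ℤ)), f (proj y) = 0) :
    mFourierCoeff (fun x => (f x : ℂ)) 0 = 0 := by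
  rw [mFourierCoeff_zero_eq_integral, integral_complex_ofReal, Complex.ofReal_eq_zero, integral_eq_integral_lift_holds f]
  simp only [show lift f = fun y => f (proj y) from funext fun y => lift_apply f y]
  rw [setIntegral_unitCube_eq_sum_latticeCell hm (g := fun y => f (proj y))
    (integrableOn_unitCube_of_continuous (hf.comp continuous_proj))]
  exact Finset.sum_eq_zero fun κ _ => h0 κ

/-- `L²` mass of a bounded function on the probability space `T^d`. [folklore] -/
theorem rpow_half_lintegral_enorm_sq_le_of_abs_le {f : UnitAddTorus d → ℝ} {M : ℝ} (hM : ∀ x, |f x| ≤ M) :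
    (∫⁻ x, ‖f x‖ₑ ^ (2 : ℝ)) ^ (1 / 2 : ℝ) ≤ ENNReal.ofReal M := by
  have h1 : ∫⁻ x, ‖f x‖ₑ ^ (2 : ℝ) ≤ ∫⁻ _ : UnitAddTorus d, ENNReal.ofReal M ^ (2 : ℝ) := by
    refine lintegral_mono fun x => ENNReal.rpow_le_rpow ?_ (by norm_num)
    rw [Real.enorm_eq_ofReal_abs]
    exact ENNReal.ofReal_le_ofReal (hM x)
  rw [lintegral_const, measure_univ, mul_one] at h1
  calc (∫⁻ x, ‖f x‖ₑ ^ (2 : ℝ)) ^ (1 / 2 : ℝ) ≤ (ENNReal.ofReal M ^ (2 : ℝ)) ^ (1 / 2 : ℝ) := ENNReal.rpow_le_rpow h1 (by norm_num)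
    _ = ENNReal.ofReal M := by rw [← ENNReal.rpow_mul]; norm_num

/-- The constant of the cellwise `H⁻¹` bound. [folklore] -/
def hNegConst (d : Type*) [Fintype d] (m : ℕ) : ℝ≥0∞ :=
  ENNReal.ofReal (2 * Real.pi * (Real.sqrt (Fintype.card d) / m)) * 2 ^ ((Fintype.card d : ℝ) / 2)

/-- The constant of the cellwise `H⁻¹` bound tends to zero: it is at most `ofReal (C_d / m)` with
`C_d = 2π √d 2^{d/2}`. [folklore] -/
theorem hNegConst_eq (m : ℕ) :
    hNegConst d m = ENNReal.ofReal (2 * Real.pi * Real.sqrt (Fintype.card d) * 2 ^ ((Fintype.card d : ℝ) / 2) / m) := by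
  rw [hNegConst, show (2 : ℝ≥0∞) ^ ((Fintype.card d : ℝ) / 2) = ENNReal.ofReal ((2 : ℝ) ^ ((Fintype.card d : ℝ) / 2)) by
    rw [← ENNReal.ofReal_rpow_of_pos two_pos]; norm_num, ← ENNReal.ofReal_mul (by positivity)]
  congr 1; ring

/-- **Scalar bound**: a continuous real function bounded by `M` with vanishing integrals on all cells
of mesh `m⁻¹` has `‖f‖_{H⁻¹} ≤ hNegConst d m · M`. [cite: BrueDeLellisCMP2023, Thm. 4.1 (b)] -/
theorem eSobolevNorm_neg_one_ofReal_le_of_cellwise [DecidableEq d] [Nonempty d] {f : UnitAddTorus d → ℝ}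
    (hf : Continuous f) {m : ℕ} (hm : 0 < m)
    (h0 : ∀ κ : d → Fin m, ∫ y in latticeCell m (fun i => ((κ i : ℕ) : ℤ)), f (proj y) = 0)
    {M : ℝ} (hM : ∀ x, |f x| ≤ M) :
    eSobolevNorm (-1) (fun x => (f x : ℂ)) ≤ hNegConst d m * ENNReal.ofReal M :=
  calc eSobolevNorm (-1) (fun x => (f x : ℂ)) ≤ eHomSobolevSeminorm (-1) (fun x => (f x : ℂ)) :=
        eSobolevNorm_neg_one_le_eHomSobolevSeminorm (mFourierCoeff_zero_eq_zero_of_cellwise hf hm h0)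
    _ ≤ hNegConst d m * (∫⁻ x, ‖f x‖ₑ ^ (2 : ℝ)) ^ (1 / 2 : ℝ) := eHomSobolevSeminorm_neg_one_le_of_cellwise hf hm h0
    _ ≤ hNegConst d m * ENNReal.ofReal M := mul_le_mul_right (rpow_half_lintegral_enorm_sq_le_of_abs_le hM) _

/-- **Vector bound**: a continuous field `V : T^d → ℝ^d` bounded by `M` whose coordinates have
vanishing integrals on all cells of mesh `m⁻¹` has
`‖complexify ∘ V‖_{H⁻¹} ≤ √d · hNegConst d m · M`. [cite: BrueDeLellisCMP2023, Thm. 4.1 (b)] -/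
theorem eSobolevNorm_neg_one_complexify_le_of_cellwise [DecidableEq d] [Nonempty d]
    {V : UnitAddTorus d → EuclideanSpace ℝ d} (hV : Continuous V) {m : ℕ} (hm : 0 < m)
    (h0 : ∀ i, ∀ κ : d → Fin m, ∫ y in latticeCell m (fun i => ((κ i : ℕ) : ℤ)), V (proj y) i = 0)
    {M : ℝ} (hM : ∀ x, ‖V x‖ ≤ M) :
    eSobolevNorm (-1) (EuclideanSpace.complexify ∘ V) ≤
      (Fintype.card d : ℝ≥0∞) ^ (1 / 2 : ℝ) * (hNegConst d m * ENNReal.ofReal M) := by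
  have hVi : Integrable V volume := hV.integrable_unitAddTorus
  have hci : ∀ i, Continuous fun x => V x i := fun i => (PiLp.continuous_apply 2 (fun _ : d => ℝ) i).comp hV
  have hbi : ∀ i x, |V x i| ≤ M := fun i x =>
    (by simpa using PiLp.norm_apply_le (V x) i : |V x i| ≤ ‖V x‖).trans (hM x)
  have hcoord : ∀ i, eSobolevNorm (-1) (fun x => (V x i : ℂ)) ≤ hNegConst d m * ENNReal.ofReal M := fun i =>
    eSobolevNorm_neg_one_ofReal_le_of_cellwise (hci i) hm (h0 i) (hbi i)
  have hsq : eSobolevNorm (-1) (EuclideanSpace.complexify ∘ V) ^ (2 : ℝ) ≤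
      (Fintype.card d : ℝ≥0∞) * (hNegConst d m * ENNReal.ofReal M) ^ (2 : ℝ) := by
    rw [eSobolevNorm_complexify_sq hVi]
    calc ∑ i, eSobolevNorm (-1) (fun x => (V x i : ℂ)) ^ (2 : ℝ) ≤ ∑ _i : d, (hNegConst d m * ENNReal.ofReal M) ^ (2 : ℝ) :=
          Finset.sum_le_sum fun i _ => ENNReal.rpow_le_rpow (hcoord i) (by norm_num)
      _ = (Fintype.card d : ℝ≥0∞) * (hNegConst d m * ENNReal.ofReal M) ^ (2 : ℝ) := by
          rw [Finset.sum_const, Finset.card_univ, nsmul_eq_mul]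
  have h := ENNReal.rpow_le_rpow hsq (show (0 : ℝ) ≤ 1 / 2 by norm_num)
  rw [← ENNReal.rpow_mul, show (2 : ℝ) * (1 / 2) = 1 by norm_num, ENNReal.rpow_one,
    ENNReal.mul_rpow_of_nonneg _ _ (by norm_num : (0 : ℝ) ≤ 1 / 2), ← ENNReal.rpow_mul,
    show (2 : ℝ) * (1 / 2) = 1 by norm_num, ENNReal.rpow_one] at h
  exact h

end Torus

end Literature.Analysis.FunctionSpaces
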